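import Summits.BirchSwinnertonDyer.BirchSwinnertonDyer.Theorems.KatoDescentTamePotSupersingularTameUpperUnitTwistRoad
import Summits.BirchSwinnertonDyer.BirchSwinnertonDyer.Theorems.AdditiveRankZeroUnitTwistCertificateKernels
import Literature.NumberTheory.EllipticCurves.HeegnerHypothesisKroneckerProofs
import HarnessLib

/-!
# Route `KatoDescentTamePotSupersingular` (rung K8, sub-rung B4 (t′), cell `bsd-potss`): the two UNIT-TWIST roads of the U₀-ns
# node in RECORD-INPUT form (seat `bsd-potss-k8t-c4` g14; route-free; certificate shapes — nothing booked, no item closed,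
# BSD is not proved by any of this)

WHY. The per-row kernel RECORDS of the U₀-ns rows of items 19202 / 19982 (rank `0`, `E[p]` irreducible, `p`-adic tower not onto,
(t′) at an additive potentially supersingular `p`) instantiate one of two roads at a literal curve:

* ♭ rows (`p ∤ ∏ c_ℓ(E)`): kmc's F15 `AdditiveUnitTwistCertificate.missingUpperBoundAt_rankZero_irreducible_at_unitTwistDatum_of_matarNekovar`
  (p574309) — PUBLISHED inputs only {Gross–Zagier, Kolyvagin, Matar–Nekovář 2019 Thm 0.3, GZK, modularity};
* ♯ rows (`p ∣ ∏ c_ℓ(E)`, ONE Tamagawa carrier `q ∥ N`): this seat's `TameUpperUnitTwistRoad.missingUpperBoundAt_rankZero_of_optimalDatum_of_jetchev08TwoSplit_of_unitTwist`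
  (p573646) — the same plus the displayed two-split Jetchev reading `hJ2` (⟸ four held named facts, k9-c4 g11 p564108).

Both take a Heegner DATUM (`H`, `ι`, `P`, the rationality witness `q₀`, the Heegner hypothesis at level `N(E)` and at `2`, `|d_K| > 4`)
that a record should not have to spell out. This file repackages them so that a record supplies exactly what a census row displays:
the conductor `N` (`hN : W.conductorNorm ℤ = N`, Cremona), a modular parametrisation datum `D` of level `N` with `p ∤ c(D)`, the
Heegner field through `hK : IsImaginaryQuadratic K` and the Heegner hypothesis at level `N` (which a record derives from `d_K` by
`satisfiesHeegnerHypothesis_iff_kronecker` and `norm_num`), `d_K ≡ 1 (mod 8)` (`2` splits) and `d_K < −4`, the globally minimal twist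
model `Wd` with an explicit isomorphism `Cd • E^{(d_K)} = Wd`, and the displayed numerics `hrd : r_an(Wd) = 1`,
`hunit : #Ш_an(Wd) ∈ ℚ` with `ord_p ≤ 0`. The Heegner datum, the `K`-rational Heegner point and `L(E,1)/Ω(E) ∈ ℚ` (Manin–Drinfeld at
`D`) are DERIVED inside (tree theorems `exists_dvd_sq_sub_discr_holds`, `nonempty_heegnerDatum_holds`,
`heegnerPointComplex_mem_range_map_holds`, `ModularParametrizationData.exists_rat_mul_realPeriodRat_eq_plusPeriod`,
`IsNewformOf.entireLFunction_one_eq`).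

* §1 `missingUpperBoundAt_flat_of_datum_of_unitTwist` — ♭ road in record-input form (over F15).
* §2 `missingUpperBoundAt_sharp_of_datum_of_unitTwist` — ♯ road in record-input form (over p573646).

HONEST FRAMING: CONDITIONAL on every displayed hypothesis (named published facts; on ♯ rows the schema `hJ2`); the twist's analytic
rank and `#Ш_an` are NUMERICAL data displayed as hypotheses by the records; per-ROW statements (never a ∀-item); closes nothing;
0 definitions, 0 named facts minted, 0 `sorry`.

References: [MatarNekovar2019] Thm. 0.3, Thm. 0.7, §0.11; [Jetchev2008] Thm. 1.4, Cor. 1.5, Rem. 6.2; [GrossZagier1986] I.6.3, V.§2;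
[KolyvaginEulerSystems1990] Thm. A; [GrossLMS1991] §1, Prop. 3.7 (2); [Manin1972] Cor. 3.6; [EdixhovenManin1991] §1; [Marcus2018]
Ch. 3 Thm. 25; [Miller2011LMS] Def. 1.1.
-/

set_option autoImplicit false
-- the Theorems directory repeats the summit name (sibling precedent `KatoDescentPotSupersingularAssembly.lean`)
set_option linter.dupNamespace false

noncomputable section

open scoped Classical NumberField

namespace Summit.BirchSwinnertonDyer.BirchSwinnertonDyer.Theorems.TameUpperUnitTwistRecords

open WeierstrassCurve IsDedekindDomain IsDedekindDomain.HeightOneSpectrum NumberField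
  Rat.HeightOneSpectrum Literature.NumberTheory.EllipticCurves
  Literature.NumberTheory.EllipticCurves.ModularForms
  Literature.NumberTheory.DiophantineGeometry
  Literature.NumberTheory.EllipticCurves.Rank1Residual
  Literature.NumberTheory.EllipticCurves.Rank1Residual.Typed
  Literature.NumberTheory.Automorphic Literature.NumberTheory.EllipticCurves.KrizLi2019
  Literature.NumberTheory.QuadraticFields
  Summit.BirchSwinnertonDyer.Rank1Residual
  Summit.BirchSwinnertonDyer.Rank1Residual.Additive
  Summit.BirchSwinnertonDyer.BirchSwinnertonDyer.Theorems
  Summit.BirchSwinnertonDyer.BirchSwinnertonDyer.Theorems.TameUpperHeegnerSharpRoad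

/-! ### §0 Heegner-field bookkeeping from the displayed discriminant data -/

/-- `d_K ≡ 1 (mod 8)` for a quadratic field `K` gives the Heegner hypothesis at level `2` (`2` splits in `K`): the decomposition
law `satisfiesHeegnerHypothesis_iff_kronecker` at `N = 2`. [cite: Marcus2018, Ch. 3 Thm. 25] -/
theorem satisfiesHeegnerHypothesis_two_of_discr_emod_eight (K : Type) [Field K] [NumberField K]
    (h2 : Module.finrank ℚ K = 2) (h8 : NumberField.discr K % 8 = 1) : SatisfiesHeegnerHypothesis 2 K := by
  rw [satisfiesHeegnerHypothesis_iff_kronecker 2 K h2]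
  intro q hq hq2
  have hq' : q = 2 := (Nat.prime_dvd_prime_iff_eq hq Nat.prime_two).mp hq2
  exact ⟨fun _ => h8, fun h => absurd hq' h⟩

/-- `d_K ≡ 1 (mod 8)` makes `d_K` odd. [folklore] -/
theorem odd_discr_of_emod_eight (K : Type) [Field K] [NumberField K] (h8 : NumberField.discr K % 8 = 1) :
    Odd (NumberField.discr K) := by
  rw [Int.odd_iff]
  omega

/-! ### §1 The ♭ road (`p ∤ ∏ c_ℓ(E)`) in record-input form — over kmc's F15 (Matar–Nekovář 0.3; PUBLISHED inputs only) -/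

/-- **♭ UNIT-TWIST ROAD, record-input form.** For a globally minimal `W` of conductor `N` (`hN`), an odd prime `p ∣ N`, `r_an(W) = 0`,
`W[p]` irreducible, `p ∤ ∏ c_ℓ(W)`; a modular parametrisation datum `D` of level `N` with `p ∤ c(D)`; a quadratic imaginary `K`
satisfying the Heegner hypothesis at level `N` with `d_K ≡ 1 (mod 8)` and `d_K < −4`; a globally minimal `Wd` with
`Cd • W^{(d_K)} = Wd`, `r_an(Wd) = 1` and `#Ш_an(Wd) = qd ∈ ℚ` of `p`-adic valuation `≤ 0` — the UPPER half
`MissingUpperBoundAt W p`, modulo the PUBLISHED inputs Gross–Zagier (`hGZ`), Kolyvagin (`hKo`), Matar–Nekovář 2019 Thm 0.3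
(`hMN`), GZK (`hGZK`), modularity (`hmod`). Proof: the Heegner datum `H` (from `β² ≡ d_K (mod 4N)`), an embedding `ι : K → ℂ`,
the `K`-rational Heegner point `P` of `D` and `L(W,1)/Ω(W) = [0]⁺·ϖ ∈ ℚ` (Manin–Drinfeld at `D`) are produced by tree theorems and
fed to F15 `AdditiveUnitTwistCertificate.missingUpperBoundAt_rankZero_irreducible_at_unitTwistDatum_of_matarNekovar`.
CONDITIONAL on the displayed hypotheses; per row; closes nothing. [cite: MatarNekovar2019, Thm. 0.3 (p. 456), §0.11 (p. 457)]
[cite: GrossZagier1986, Thm. I.6.3, V.§2] [cite: Manin1972, Cor. 3.6] [cite: EdixhovenManin1991, §1] [cite: Miller2011LMS, Def. 1.1] -/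
theorem missingUpperBoundAt_flat_of_datum_of_unitTwist
    (hGZ : ∀ (N : ℕ) [NeZero N] (W : WeierstrassCurve ℚ) (K : Type) [Field K] [NumberField K],
      gross_zagier N W K)
    (hKo : ∀ (N : ℕ) [NeZero N] (W : WeierstrassCurve ℚ) (K : Type) [Field K] [NumberField K],
      kolyvagin N W K)
    (hMN : ∀ (N : ℕ) [NeZero N] (W : WeierstrassCurve ℚ) (K : Type) [Field K] [NumberField K],
      MatarNekovar2019.thm03_padicValNat_card_sha_le_of_irreducible N W K)
    (hGZK : rank_eq_analyticRank_of_analyticRank_le_one) (hmod : hasEntireLFunction_rat)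
    (W : WeierstrassCurve ℚ) [W.IsElliptic] [W.IsGloballyMinimal] (p : ℕ) [Fact p.Prime] (hp2 : p ≠ 2)
    {N : ℕ} [NeZero N] (hN : W.conductorNorm ℤ = N) (hpN : p ∣ N)
    (hr : W.analyticRank = 0) (hirr : W.HasIrreducibleModPGaloisRep p) (htam : ¬ p ∣ W.tamagawaProduct)
    (D : ModularParametrizationData W N) (hc : ¬ (p : ℤ) ∣ D.c)
    (K : Type) [Field K] [NumberField K] (hK : IsImaginaryQuadratic K) (hHN : SatisfiesHeegnerHypothesis N K)
    (h8 : NumberField.discr K % 8 = 1) (hd4 : NumberField.discr K < -4)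
    (Wd : WeierstrassCurve ℚ) [Wd.IsElliptic] [Wd.IsGloballyMinimal] (Cd : VariableChange ℚ)
    (hWd : Cd • W.quadraticTwist (NumberField.discr K : ℚ) = Wd) (hrd : Wd.analyticRank = 1)
    {qd : ℚ} (hqd : shaAn Wd = (qd : ℂ)) (hvd : padicValRat p qd ≤ 0) :
    MissingUpperBoundAt W p := by
  -- the Heegner datum and the `K`-rational Heegner point of the datum `D` (tree theorems)
  obtain ⟨β, hβ⟩ := exists_dvd_sq_sub_discr_holds N K hK hHN
  obtain ⟨H, -⟩ := nonempty_heegnerDatum_holds N K hK hβ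
  obtain ⟨ι⟩ : Nonempty (K →+* ℂ) := inferInstance
  obtain ⟨P, hP⟩ := heegnerPointComplex_mem_range_map_holds N W K hK hHN D H ι
  -- rationality of `L(W,1)/Ω(W)`: Manin–Drinfeld at the datum `D` (tree theorems; NO L₀ input)
  obtain ⟨q0, hq0⟩ : ∃ q0 : ℚ, W.entireLFunction 1 / (W.realPeriodRat : ℂ) = (q0 : ℂ) := by
    obtain ⟨ϖ, -, hϖ, hΩ⟩ := D.exists_rat_mul_realPeriodRat_eq_plusPeriod
    refine ⟨ratPlusSymbol D.f 0 * ϖ, ?_⟩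
    have hΩ0 : (W.realPeriodRat : ℂ) ≠ 0 := by exact_mod_cast hΩ.ne'
    rw [div_eq_iff hΩ0, D.isNewformOf.entireLFunction_one_eq, ← hϖ]
    push_cast
    ring
  exact AdditiveUnitTwistCertificate.missingUpperBoundAt_rankZero_irreducible_at_unitTwistDatum_of_matarNekovar W p hp2
    hN hpN K D H ι P (hGZ N W K) (hKo N W K) (hMN N W K) hGZK hmod hK hHN (odd_discr_of_emod_eight K h8) hd4 hP hc
    hr hirr htam q0 hq0 Wd ⟨Cd, hWd⟩ hrd ⟨qd, hqd, hvd⟩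

/-! ### §2 The ♯ road (`p ∣ ∏ c_ℓ(E)`, one carrier `q ∥ N`) in record-input form — over this seat's p573646 (two-split Jetchev reading) -/

/-- **♯ UNIT-TWIST ROAD, record-input form.** The road `TameUpperUnitTwistRoad.missingUpperBoundAt_rankZero_of_optimalDatum_of_jetchev08TwoSplit_of_unitTwist`
(p573646) with its Heegner-field inputs repackaged for records: the conductor is displayed as `hN : W.conductorNorm ℤ = N`, the datum
`D` is of level `N`, the Heegner hypothesis is given at level `N` (`hHN`), and the hypotheses `|d_K| > 4`, «`2` splits in `K`» are
derived from `d_K ≡ 1 (mod 8)` (`h8`) and `d_K < −4` (`hd4`); the unit certificate is given as `(qd, hqd, hvd)`. Row inputs as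
in p573646: `r_an(W) = 0`, `Addv W p`, `ord_p j ≥ 0`, non-CM, `W[p]` irreducible with `p`-adic tower NOT onto, `p ∤ c_p(W)`, the
lattice-OPTIMAL datum `D` (`hopt`) with `p ∤ c(D)`, the single Tamagawa carrier (`hsingle`), and the schema `hJ2` (two-split
Jetchev reading ⟸ Matar–Nekovář 0.7 + Gross 3.7 (2) + Poitou–Tate + GZ86 III (3.1), k9-c4 g11). CONDITIONAL on the displayed
hypotheses; per row; closes nothing. [cite: Jetchev2008, Thm. 1.4, Cor. 1.5 (p. 3), Rem. 6.2] [cite: MatarNekovar2019, Thm. 0.3 (p. 456)]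
[cite: GrossZagier1986, Thm. I.6.3] [cite: Manin1972, Cor. 3.6] [cite: Miller2011LMS, Def. 1.1] -/
theorem missingUpperBoundAt_sharp_of_datum_of_unitTwist
    (hGZ : ∀ (N : ℕ) [NeZero N] (W : WeierstrassCurve ℚ) (K : Type) [Field K] [NumberField K],
      gross_zagier N W K)
    (hKo : ∀ (N : ℕ) [NeZero N] (W : WeierstrassCurve ℚ) (K : Type) [Field K] [NumberField K],
      kolyvagin N W K)
    (hMN : ∀ (N : ℕ) [NeZero N] (W : WeierstrassCurve ℚ) (K : Type) [Field K] [NumberField K],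
      MatarNekovar2019.thm03_padicValNat_card_sha_le_of_irreducible N W K)
    (hGZK : rank_eq_analyticRank_of_analyticRank_le_one) (hmod : hasEntireLFunction_rat)
    (hJ2 : ∀ (N : ℕ) [NeZero N] (W : WeierstrassCurve ℚ) [W.IsElliptic] [W.IsGloballyMinimal]
      (K : Type) [Field K] [NumberField K],
      IsImaginaryQuadratic K → NumberField.discr K ≠ -3 → NumberField.discr K ≠ -4 →
      SatisfiesHeegnerHypothesis N K → SatisfiesHeegnerHypothesis 2 K →
      ∀ (p : ℕ) [Fact p.Prime], p ≠ 2 → W.analyticRank = 0 → Addv W p → 0 ≤ padicValRat p W.j →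
      ¬ W.HasCM → W.HasIrreducibleModPGaloisRep p →
      ¬ (∀ n : ℕ, W.HasSurjectiveModNGaloisRep (p ^ n : ℕ)) →
      (∃ Dt : ModularParametrizationData W N,
        (∀ z ∈ Dt.L.lattice, ∃ w ∈ periodLattice Dt.f, z = (Dt.c : ℂ) * w) ∧ ¬ (p : ℤ) ∣ Dt.c) →
      ¬ p ∣ (W.baseChange ℚ_[p]).localTamagawaNumber ℤ_[p] →
      (∀ (q' : ℕ) [Fact q'.Prime], q' ∣ N →
        p ∣ (W.baseChange ℚ_[q']).localTamagawaNumber ℤ_[q'] → ¬ q' ^ 2 ∣ N) →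
      ∀ {P : (W.baseChange K).toAffine.Point}, IsHeegnerPoint N W K P → ¬ IsOfFinAddOrder P →
      ∀ (q : ℕ) [Fact q.Prime], q ∣ N → ¬ q ^ 2 ∣ N → q ≠ p →
      padicValNat p (Nat.card (AddCommGroup.primaryComponent (W.baseChange K).sha p)) +
          2 * padicValNat p ((W.baseChange ℚ_[q]).localTamagawaNumber ℤ_[q]) ≤
        2 * padicValNat p (AddSubgroup.zmultiples P).index)
    (W : WeierstrassCurve ℚ) [W.IsElliptic] [W.IsGloballyMinimal] (p : ℕ) [Fact p.Prime] (hp2 : p ≠ 2)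
    {N : ℕ} [NeZero N] (hN : W.conductorNorm ℤ = N)
    (hr : W.analyticRank = 0) (hadd : Addv W p) (hj : 0 ≤ padicValRat p W.j) (hcm : ¬ W.HasCM)
    (hirr : W.HasIrreducibleModPGaloisRep p) (hns : ¬ (∀ n : ℕ, W.HasSurjectiveModNGaloisRep (p ^ n : ℕ)))
    (hcp : ¬ p ∣ (W.baseChange ℚ_[p]).localTamagawaNumber ℤ_[p])
    (D : ModularParametrizationData W N)
    (hopt : ∀ z ∈ D.L.lattice, ∃ w ∈ periodLattice D.f, z = (D.c : ℂ) * w) (hc : ¬ (p : ℤ) ∣ D.c)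
    (hsingle : p ∣ W.tamagawaProduct → ∃ (q : ℕ) (_ : Fact q.Prime), q ∣ N ∧ ¬ q ^ 2 ∣ N ∧ q ≠ p ∧
      padicValNat p W.tamagawaProduct ≤ padicValNat p ((W.baseChange ℚ_[q]).localTamagawaNumber ℤ_[q]))
    (K : Type) [Field K] [NumberField K] (hK : IsImaginaryQuadratic K) (hHN : SatisfiesHeegnerHypothesis N K)
    (h8 : NumberField.discr K % 8 = 1) (hd4 : NumberField.discr K < -4)
    (Wd : WeierstrassCurve ℚ) [Wd.IsElliptic] [Wd.IsGloballyMinimal] (Cd : VariableChange ℚ)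
    (hWd : Cd • W.quadraticTwist (NumberField.discr K : ℚ) = Wd) (hrd : Wd.analyticRank = 1)
    {qd : ℚ} (hqd : shaAn Wd = (qd : ℂ)) (hvd : padicValRat p qd ≤ 0) :
    MissingUpperBoundAt W p := by
  subst hN
  have hB : 4 < (NumberField.discr K).natAbs := by omega
  have h2K : SatisfiesHeegnerHypothesis 2 K := satisfiesHeegnerHypothesis_two_of_discr_emod_eight K hK.1 h8
  exact TameUpperUnitTwistRoad.missingUpperBoundAt_rankZero_of_optimalDatum_of_jetchev08TwoSplit_of_unitTwist hGZ hKo hMN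
    hGZK hmod hJ2 W p hr hp2 hadd hj hcm hirr hns hcp D hopt hc hsingle K hK hB hHN h2K Wd Cd hWd hrd ⟨qd, hqd, hvd⟩

end Summit.BirchSwinnertonDyer.BirchSwinnertonDyer.Theorems.TameUpperUnitTwistRecords
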